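import Literature.Combinatorics.LorentzianPolynomials.LorentzianMeasures
import Literature.Combinatorics.LorentzianPolynomials.StableLorentzian
import Literature.Combinatorics.StablePolynomials.RealStableMultiaffineCriterion
import Literature.Combinatorics.StablePolynomials.Homogenization
import Literature.Combinatorics.StablePolynomials.PartialSymmetrization
import HarnessLib

/-!
# Strongly Rayleigh measures are Lorentzian (Brändén–Huh 2020, §4.5 Prop. 4.24)

Layer `Literature/Combinatorics/LorentzianPolynomials`, namespace `Literature.Combinatorics.LorentzianPolynomials`;
companion of `LorentzianMeasures.lean` (Def. 4.20 `IsLorentzianMeasure`, the homogenised partition function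
`homPartitionPoly μ = Σ_S μ(S) w_0^{n-|S|} w^S`, Props. 4.21, 4.25), which lists Prop. 4.24 as not treated.

## Source (verbatim) — P. Brändén, J. Huh, *Lorentzian polynomials* [BrandenHuh2019] (held `paper:arxiv-1902.03719`), §4.5

(p. 58, before Def. 4.20) "The measure `μ` is *strongly Rayleigh* if for all distinct `i` and `j` in `[n]`,
`Z_μ(w) ∂_i∂_j Z_μ(w) ≤ ∂_i Z_μ(w) ∂_j Z_μ(w)` for all `w ∈ ℝ^n`", `Z_μ(w) = Σ_S μ(S) w^S` the partition function of
the discrete probability measure `μ` on `{0,1}^n`. (p. 59) "**Proposition 4.24.** If `μ` is strongly Rayleigh, then `μ`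
is Lorentzian. *Proof.* A multi-affine polynomial is stable if and only if it is strongly Rayleigh [Brä07], and a
polynomial with nonnegative coefficients is stable if and only if its homogenization is stable [BBL09]. By
Proposition 2.2, homogeneous stable polynomials with nonnegative coefficients are Lorentzian."

## What is here

* §1 the partition function `partitionPoly μ = Z_μ = Σ_S μ(S) w^S ∈ ℝ[w_σ]` of a weight `μ : Set σ → ℝ`: coefficients,
  multi-affinity, degree, and `homogenize |σ| (partitionPoly μ) = homPartitionPoly μ` (the tree's homogenised
  partition function IS the Borcea–Brändén–Liggett homogenization of `Z_μ` in degree `n = |σ|`).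
* §2 `IsStronglyRayleighMeasure μ` (as printed, all `w ∈ ℝ^n`, distinct `i, j`); it is equivalent to
  "`Z_μ = 0` or `Z_μ` real stable" — [Brä07] = Brändén 2007 Thm. 5.6, tree `eq_zero_or_isRealStable_of_rayleighDiff_nonneg` /
  `rayleighDiff_nonneg_of_isRealStable` (the diagonal Rayleigh differences of a multi-affine polynomial are squares).
* §3 **Proposition 4.24** `IsStronglyRayleighMeasure.isLorentzianMeasure`: a strongly Rayleigh nonnegative weight is
  Lorentzian, by the printed three steps: Brändén's criterion, [BBL09] = Borcea–Brändén–Liggett Thm. 4.5 (tree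
  `IsRealStable.homogenize`), and Prop. 2.2 (tree `mem_lorentzian_of_isRealStable`).
* §4 **partial symmetrization** (Borcea–Brändén–Liggett Thm. 4.20, "in particular … the class of strongly Rayleigh
  measures on `2^{[n]}` is invariant under the partial symmetrization procedure" `μ ↦ θμ + (1 - θ)τ(μ)`, `τ = (a b)`,
  `θ ∈ [0,1]` — the one-pair step of the symmetric exclusion process, Prop. 5.1; Brändén–Huh §3.1: "In [BBL], it was
  proved that strongly Rayleigh measures are preserved under the symmetric exclusion process"):
  `IsStronglyRayleighMeasure.partialSymmetrization`, from the polynomial form (tree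
  `IsRealStable.partialSymmetrization`, `StablePolynomials/PartialSymmetrization.lean`).

Three definitions with bodies (`partitionPoly`, `IsStronglyRayleighMeasure`, `partialSymmetrizationMeasure`), theorems
otherwise; no `sorry`, no named fact.
The normalisation `μ({0,1}^n) = 1` of a probability measure plays no role and is not assumed (only `μ ≥ 0`, which
is needed: `1 - w_1 w_2` is strongly Rayleigh and stable but not Lorentzian).

## References

* P. Brändén, J. Huh, *Lorentzian polynomials*, Ann. of Math. 192 (2020) 821–891; arXiv:1902.03719v4, §4.5
  (strongly Rayleigh measures, Def. 4.20, Prop. 4.24). [BrandenHuh2019]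
* P. Brändén, *Polynomials with the half-plane property and matroid theory*, Adv. Math. 216 (2007), Thm. 5.6.
  [Branden2007]
* J. Borcea, P. Brändén, T. M. Liggett, *Negative dependence and the geometry of polynomials*, J. Amer. Math. Soc. 22
  (2009), Def. 2.9 (strongly Rayleigh measures) and Thm. 4.5. [BorceaBrandenLiggett2007]
-/

noncomputable section

open MvPolynomial Finsupp Finset
open Literature.Combinatorics.StablePolynomials

namespace Literature.Combinatorics.LorentzianPolynomials

variable {σ : Type*} [Fintype σ]

/-! ## §1 The partition function `Z_μ` and its homogenization -/

section PartitionPoly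

/-- **The partition function `Z_μ(w) = Σ_{S ⊆ [n]} μ(S) w^S`** of a weight `μ` on the subsets of `σ` (Brändén–Huh,
§4.5: "`Z_μ(w) = Σ_{S ⊆ [n]} μ(S) Π_{i ∈ S} w_i`", the partition function of a discrete probability measure on
`{0,1}^n`). [cite: BrandenHuh2019, §4.5 (definition of the partition function `Z_μ`, p. 58)] -/
def partitionPoly (μ : Set σ → ℝ) : MvPolynomial σ ℝ := ∑ S : Set σ, monomial (indSet S) (μ S)

/-- `partitionPoly` unfolded. [cite: BrandenHuh2019, §4.5 (p. 58)] -/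
theorem partitionPoly_def (μ : Set σ → ℝ) : partitionPoly μ = ∑ S : Set σ, monomial (indSet S) (μ S) := rfl

/-- The coefficients of `Z_μ`: `[w^α] Z_μ = Σ_{S : e_S = α} μ(S)` (at most one term). [cite: BrandenHuh2019, §4.5
(p. 58)] -/
theorem coeff_partitionPoly [DecidableEq σ] (μ : Set σ → ℝ) (m : σ →₀ ℕ) :
    coeff m (partitionPoly μ) = ∑ S : Set σ, if indSet S = m then μ S else 0 := by
  rw [partitionPoly, coeff_sum]
  exact Finset.sum_congr rfl fun S _ ↦ by rw [coeff_monomial]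

/-- `[w^S] Z_μ = μ(S)`. [cite: BrandenHuh2019, §4.5 (p. 58)] -/
theorem coeff_indSet_partitionPoly (μ : Set σ → ℝ) (S : Set σ) : coeff (indSet S) (partitionPoly μ) = μ S := by
  classical
  rw [coeff_partitionPoly, Finset.sum_eq_single_of_mem S (Finset.mem_univ S) fun T _ hT ↦ by
    rw [if_neg fun h ↦ hT (indSet_injective h)]]
  rw [if_pos rfl]

/-- A coefficient of `Z_μ` at an exponent that is not a `0/1` vector vanishes. [cite: BrandenHuh2019, §4.5 (p. 58)] -/
theorem coeff_partitionPoly_eq_zero (μ : Set σ → ℝ) {m : σ →₀ ℕ} (hm : ∀ S : Set σ, indSet S ≠ m) :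
    coeff m (partitionPoly μ) = 0 := by
  classical
  rw [coeff_partitionPoly]
  exact Finset.sum_eq_zero fun S _ ↦ if_neg (hm S)

/-- `Z_μ` has nonnegative coefficients when `μ ≥ 0`. [cite: BrandenHuh2019, §4.5 (p. 58)] -/
theorem coeff_partitionPoly_nonneg {μ : Set σ → ℝ} (hμ : ∀ S, 0 ≤ μ S) (m : σ →₀ ℕ) :
    0 ≤ coeff m (partitionPoly μ) := by
  classical
  rw [coeff_partitionPoly]
  exact Finset.sum_nonneg fun S _ ↦ by split_ifs <;> [exact hμ S; exact le_rfl]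

/-- `Z_μ = 0` iff `μ = 0`. [cite: BrandenHuh2019, §4.5 (p. 58)] -/
theorem partitionPoly_eq_zero_iff (μ : Set σ → ℝ) : partitionPoly μ = 0 ↔ μ = 0 := by
  constructor
  · intro h
    funext S
    rw [← coeff_indSet_partitionPoly μ S, h, coeff_zero, Pi.zero_apply]
  · rintro rfl
    rw [partitionPoly]
    exact Finset.sum_eq_zero fun S _ ↦ by rw [Pi.zero_apply, monomial_zero]

/-- **`Z_μ` is multi-affine** ("when `f` is multi-affine, that is, when `f` has degree at most one in each variable";
the partition function of a measure on `{0,1}^n` is). [cite: BrandenHuh2019, §2.3 (p. 16) and §4.5 (p. 58)] -/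
theorem isMultiAffine_partitionPoly (μ : Set σ → ℝ) : IsMultiAffine (partitionPoly μ) := by
  classical
  rw [isMultiAffine_iff_support]
  intro m hm i
  by_contra hmi
  refine MvPolynomial.mem_support_iff.1 hm (coeff_partitionPoly_eq_zero μ fun S h ↦ hmi ?_)
  rw [← h]
  exact indSet_le_one S i

/-- `deg Z_μ ≤ n`. [cite: BrandenHuh2019, §4.5 (p. 58)] -/
theorem totalDegree_partitionPoly_le (μ : Set σ → ℝ) : (partitionPoly μ).totalDegree ≤ Fintype.card σ := by
  rw [partitionPoly]
  refine totalDegree_finsetSum_le fun S _ ↦ (totalDegree_monomial_le _ _).trans ?_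
  have h : ((indSet S).sum fun _ ↦ id) = (indSet S).degree := rfl
  rw [h, degree_indSet]
  exact ncard_le_card S

/-- The homogenised exponent of `S` is the lift `(e_S, n - |S|)` of `e_S`. [cite: BrandenHuh2019, §4.5 Def. 4.20] -/
theorem homIndSet_eq_optionElim (S : Set σ) :
    homIndSet S = (indSet S).optionElim (Fintype.card σ - (indSet S).degree) := by
  refine Finsupp.ext fun o ↦ ?_
  cases o with
  | none => rw [homIndSet_none, Finsupp.optionElim_apply_none, degree_indSet]
  | some i => rw [homIndSet_some, Finsupp.optionElim_apply_some]

/-- **The homogenised partition function is the homogenization of `Z_μ` in degree `n`:**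
`w_0^n Z_μ(w_1/w_0, …, w_n/w_0) = (Z_μ)_H · w_0^{n - deg Z_μ}`, i.e. `homPartitionPoly μ = homogenize n (partitionPoly μ)`
(Borcea–Brändén–Liggett's `f_H` padded to degree `n`). [cite: BrandenHuh2019, §4.5 Def. 4.20 (p. 59)]
[cite: BorceaBrandenLiggett2007, §4.1 (definition of `f_H`)] -/
theorem homogenize_partitionPoly (μ : Set σ → ℝ) :
    homogenize (Fintype.card σ) (partitionPoly μ) = homPartitionPoly μ := by
  classical
  ext n
  rw [coeff_homogenize, homPartitionPoly, coeff_sum, coeff_partitionPoly]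
  simp only [coeff_monomial]
  -- termwise: `homIndSet S = n` iff `e_S = n|_σ` and `n₀ = card σ - |n|_σ|`
  by_cases hn : n none = Fintype.card σ - n.some.degree
  · rw [if_pos hn]
    refine Finset.sum_congr rfl fun S _ ↦ ?_
    congr 1
    refine propext ⟨fun h ↦ ?_, fun h ↦ ?_⟩
    · rw [homIndSet_eq_optionElim, h, ← hn]
      exact Finsupp.optionElim_some n
    · rw [← h, homIndSet_eq_optionElim, Finsupp.some_optionElim]
  · rw [if_neg hn]
    refine (Finset.sum_eq_zero fun S _ ↦ if_neg fun h ↦ hn ?_).symm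
    rw [← h, homIndSet_eq_optionElim, Finsupp.optionElim_apply_none, Finsupp.some_optionElim]

/-- The homogenised partition function is homogeneous of degree `n`. [cite: BrandenHuh2019, §4.5 Def. 4.20] -/
theorem isHomogeneous_homPartitionPoly (μ : Set σ → ℝ) : (homPartitionPoly μ).IsHomogeneous (Fintype.card σ) := by
  rw [← homogenize_partitionPoly]
  exact isHomogeneous_homogenize (totalDegree_partitionPoly_le μ)

/-- The homogenised partition function of a nonnegative weight has nonnegative coefficients.
[cite: BrandenHuh2019, §4.5 Def. 4.20] -/
theorem coeff_homPartitionPoly_nonneg {μ : Set σ → ℝ} (hμ : ∀ S, 0 ≤ μ S) (n : Option σ →₀ ℕ) :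
    0 ≤ coeff n (homPartitionPoly μ) := by
  rw [← homogenize_partitionPoly]
  exact coeff_homogenize_nonneg (coeff_partitionPoly_nonneg hμ) _ _

end PartitionPoly

/-! ## §2 Strongly Rayleigh measures -/

section StronglyRayleigh

/-- **Strongly Rayleigh measure** (Brändén–Huh, §4.5, after Borcea–Brändén–Liggett Def. 2.9): "The measure `μ` is
strongly Rayleigh if for all distinct `i` and `j` in `[n]`, `Z_μ(w) ∂_i∂_j Z_μ(w) ≤ ∂_i Z_μ(w) ∂_j Z_μ(w)` for all
`w ∈ ℝ^n`." Stated for any weight `μ : Set σ → ℝ`. [cite: BrandenHuh2019, §4.5 (strongly Rayleigh, p. 58)]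
[cite: BorceaBrandenLiggett2007, §2.3 Def. 2.9] -/
def IsStronglyRayleighMeasure (μ : Set σ → ℝ) : Prop :=
  ∀ i j : σ, i ≠ j → ∀ w : σ → ℝ,
    eval w (partitionPoly μ) * eval w (pderiv i (pderiv j (partitionPoly μ))) ≤
      eval w (pderiv i (partitionPoly μ)) * eval w (pderiv j (partitionPoly μ))

/-- Unfolding. [cite: BrandenHuh2019, §4.5 (p. 58)] -/
theorem isStronglyRayleighMeasure_iff (μ : Set σ → ℝ) :
    IsStronglyRayleighMeasure μ ↔ ∀ i j : σ, i ≠ j → ∀ w : σ → ℝ,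
      eval w (partitionPoly μ) * eval w (pderiv i (pderiv j (partitionPoly μ))) ≤
        eval w (pderiv i (partitionPoly μ)) * eval w (pderiv j (partitionPoly μ)) :=
  Iff.rfl

/-- The strong Rayleigh inequalities are the nonnegativity of Brändén's Rayleigh differences
`Δ_ij(Z_μ) = ∂_i Z_μ ∂_j Z_μ - ∂_i∂_j Z_μ · Z_μ` on `ℝ^n`, the diagonal ones `Δ_ii(Z_μ) = (∂_i Z_μ)²` being automatic for
the multi-affine `Z_μ`. [cite: BrandenHuh2019, §4.5 proof of Prop. 4.24] [cite: Branden2007, §5 Thm. 5.6] -/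
theorem isStronglyRayleighMeasure_iff_rayleighDiff_nonneg (μ : Set σ → ℝ) :
    IsStronglyRayleighMeasure μ ↔ ∀ (w : σ → ℝ) (i j : σ), 0 ≤ eval w (rayleighDiff i j (partitionPoly μ)) := by
  have hval : ∀ (w : σ → ℝ) (i j : σ), eval w (rayleighDiff i j (partitionPoly μ)) =
      eval w (pderiv i (partitionPoly μ)) * eval w (pderiv j (partitionPoly μ)) -
        eval w (partitionPoly μ) * eval w (pderiv i (pderiv j (partitionPoly μ))) := by
    intro w i j
    simp only [rayleighDiff, map_sub, map_mul]
    ring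
  simp only [hval, sub_nonneg]
  constructor
  · intro h w i j
    rcases eq_or_ne i j with rfl | hij
    · rw [pderiv_pderiv_self_of_isMultiAffine (isMultiAffine_partitionPoly μ), map_zero, mul_zero]
      exact mul_self_nonneg _
    · exact h i j hij w
  · intro h i j _ w
    exact h w i j

/-- **"A multi-affine polynomial is stable if and only if it is strongly Rayleigh [Brä07]"**, forward half for
measures: the partition function of a strongly Rayleigh weight is `0` or real stable (Brändén 2007, Thm. 5.6
(1) ⇒ (2), tree `eq_zero_or_isRealStable_of_rayleighDiff_nonneg`). [cite: BrandenHuh2019, §4.5 proof of Prop. 4.24]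
[cite: Branden2007, §5 Thm. 5.6] -/
theorem IsStronglyRayleighMeasure.eq_zero_or_isRealStable {μ : Set σ → ℝ} (h : IsStronglyRayleighMeasure μ) :
    partitionPoly μ = 0 ∨ IsRealStable (partitionPoly μ) :=
  eq_zero_or_isRealStable_of_rayleighDiff_nonneg σ _ (isMultiAffine_partitionPoly μ)
    ((isStronglyRayleighMeasure_iff_rayleighDiff_nonneg μ).1 h)

/-- **"… if and only if …"**, backward half: a weight whose partition function is real stable is strongly Rayleigh
(Brändén 2007, Thm. 5.6 (2) ⇒ (1), tree `rayleighDiff_nonneg_of_isRealStable`). [cite: BrandenHuh2019, §4.5 proof of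
Prop. 4.24] [cite: Branden2007, §5 Thm. 5.6] -/
theorem isStronglyRayleighMeasure_of_isRealStable [DecidableEq σ] {μ : Set σ → ℝ}
    (h : IsRealStable (partitionPoly μ)) : IsStronglyRayleighMeasure μ :=
  (isStronglyRayleighMeasure_iff_rayleighDiff_nonneg μ).2 fun w i j ↦
    rayleighDiff_nonneg_of_isRealStable (isMultiAffine_partitionPoly μ) h w i j

/-- The zero weight is (vacuously) strongly Rayleigh. [cite: BrandenHuh2019, §4.5 (p. 58)] -/
theorem isStronglyRayleighMeasure_zero : IsStronglyRayleighMeasure (0 : Set σ → ℝ) := by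
  intro i j _ w
  rw [(partitionPoly_eq_zero_iff _).2 rfl]
  simp

end StronglyRayleigh

/-! ## §3 Proposition 4.24 -/

section Prop424

variable [DecidableEq σ]

/-- **Brändén–Huh, Proposition 4.24: "If `μ` is strongly Rayleigh, then `μ` is Lorentzian."** For a nonnegative
weight `μ` on the subsets of `σ` (a discrete probability measure up to normalisation): `Z_μ` is multi-affine and
strongly Rayleigh, hence `0` or real stable [Brä07]; it has nonnegative coefficients, so its homogenization
`w_0^n Z_μ(w/w_0) = homPartitionPoly μ` is real stable [BBL09, Thm. 4.5]; a homogeneous real stable polynomial with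
nonnegative coefficients is Lorentzian (Prop. 2.2). [cite: BrandenHuh2019, §4.5 Prop. 4.24 (p. 59)] -/
theorem IsStronglyRayleighMeasure.isLorentzianMeasure {μ : Set σ → ℝ} (hR : IsStronglyRayleighMeasure μ)
    (hμ : ∀ S, 0 ≤ μ S) : IsLorentzianMeasure μ := by
  rw [isLorentzianMeasure_iff, ← homogenize_partitionPoly]
  rcases hR.eq_zero_or_isRealStable with h0 | hst
  · rw [h0, (homogenize_eq_zero_iff _ _).2 rfl]
    exact zero_mem_lorentzian _
  · exact mem_lorentzian_of_isRealStable (isHomogeneous_homogenize (totalDegree_partitionPoly_le μ))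
      (coeff_homogenize_nonneg (coeff_partitionPoly_nonneg hμ) _)
      (hst.homogenize (coeff_partitionPoly_nonneg hμ) (totalDegree_partitionPoly_le μ))

/-- Prop. 4.24 read through the partition function: a nonnegative weight whose partition function is real stable
(a "strongly Rayleigh probability measure" in Borcea–Brändén–Liggett's sense, Def. 2.10: `Z_μ` stable) is Lorentzian.
[cite: BrandenHuh2019, §4.5 Prop. 4.24 (proof)] [cite: BorceaBrandenLiggett2007, §2.3 Def. 2.10 and Thm. 4.5] -/
theorem isLorentzianMeasure_of_isRealStable_partitionPoly {μ : Set σ → ℝ} (hst : IsRealStable (partitionPoly μ))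
    (hμ : ∀ S, 0 ≤ μ S) : IsLorentzianMeasure μ :=
  (isStronglyRayleighMeasure_of_isRealStable hst).isLorentzianMeasure hμ

/-- Prop. 4.24 combined with Prop. 4.21: a strongly Rayleigh nonnegative weight is `2`-Rayleigh in the tree's
homogenised sense (`IsLorentzianMeasure.isCRayleigh_two`). [cite: BrandenHuh2019, §4.5 Props. 4.21, 4.24] -/
theorem IsStronglyRayleighMeasure.isCRayleigh_two {μ : Set σ → ℝ} (hR : IsStronglyRayleighMeasure μ)
    (hμ : ∀ S, 0 ≤ μ S) : IsCRayleigh 2 (homPartitionPoly μ) :=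
  (hR.isLorentzianMeasure hμ).isCRayleigh_two

end Prop424

/-! ## §4 Partial symmetrization `μ ↦ θμ + (1 - θ)τ(μ)` (Borcea–Brändén–Liggett Thm. 4.20; Prop. 5.1, one pair) -/

section Symmetrization

/-- `Z_μ` is additive in the weight. [cite: BrandenHuh2019, §4.5 (p. 58)] -/
theorem partitionPoly_add (μ ν : Set σ → ℝ) : partitionPoly (μ + ν) = partitionPoly μ + partitionPoly ν := by
  rw [partitionPoly, partitionPoly, partitionPoly, ← Finset.sum_add_distrib]
  exact Finset.sum_congr rfl fun S _ ↦ by rw [Pi.add_apply, map_add]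

/-- `Z_μ` is homogeneous in the weight. [cite: BrandenHuh2019, §4.5 (p. 58)] -/
theorem partitionPoly_smul (c : ℝ) (μ : Set σ → ℝ) : partitionPoly (c • μ) = c • partitionPoly μ := by
  rw [partitionPoly, partitionPoly, Finset.smul_sum]
  exact Finset.sum_congr rfl fun S _ ↦ by rw [Pi.smul_apply, smul_eq_mul, smul_monomial, smul_eq_mul]

/-- The `0/1` exponent of the image of `S` under a permutation `e` of the ground set is the relabelled exponent.
[folklore] -/
private theorem indSet_image_equiv (e : σ ≃ σ) (S : Set σ) : indSet (e '' S) = Finsupp.mapDomain e (indSet S) := by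
  classical
  refine Finsupp.ext fun i ↦ ?_
  rw [← Finsupp.equivMapDomain_eq_mapDomain, Finsupp.equivMapDomain_apply, indSet_apply, indSet_apply]
  simp only [Set.mem_image_equiv]

/-- **Relabelling the ground set**: `Z_μ ∘ e = Z_{e(μ)}`, i.e. `rename e (Z_μ) = Z_{μ ∘ e⁻¹}` with
`(μ ∘ e⁻¹)(S) = μ(e⁻¹(S))` the image weight `e(μ)`. [cite: BorceaBrandenLiggett2007, §4.3 (the measure `τ(μ)`)] -/
theorem rename_partitionPoly (e : σ ≃ σ) (μ : Set σ → ℝ) :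
    rename e (partitionPoly μ) = partitionPoly fun S ↦ μ (e.symm '' S) := by
  rw [partitionPoly, partitionPoly, map_sum]
  simp only [rename_monomial, ← indSet_image_equiv]
  -- reindex the sum along `S ↦ e '' S`
  let E : Set σ ≃ Set σ :=
    { toFun := fun S ↦ e '' S
      invFun := fun S ↦ e.symm '' S
      left_inv := fun S ↦ Equiv.symm_image_image e S
      right_inv := fun S ↦ Equiv.image_symm_image e S }
  conv_rhs => rw [← E.sum_comp]
  exact Finset.sum_congr rfl fun S _ ↦ by
    simp only [E, Equiv.coe_fn_mk, Equiv.symm_image_image]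

variable [DecidableEq σ]

/-- **The partial symmetrization `μ^{τ,θ} = θμ + (1 - θ)τ(μ)`** of a weight for the transposition `τ = (a b)` (the
image weight `τ(μ)(S) = μ(τ(S))`, `τ = τ⁻¹`). [cite: BorceaBrandenLiggett2007, §4.3 Thm. 4.20] -/
def partialSymmetrizationMeasure (θ : ℝ) (a b : σ) (μ : Set σ → ℝ) : Set σ → ℝ :=
  fun S ↦ θ * μ S + (1 - θ) * μ (Equiv.swap a b '' S)

omit [Fintype σ] in
/-- Unfolding. [cite: BorceaBrandenLiggett2007, §4.3 Thm. 4.20] -/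
theorem partialSymmetrizationMeasure_apply (θ : ℝ) (a b : σ) (μ : Set σ → ℝ) (S : Set σ) :
    partialSymmetrizationMeasure θ a b μ S = θ * μ S + (1 - θ) * μ (Equiv.swap a b '' S) := rfl

/-- **"The generating polynomial of `μ^{τ,θ}`" is `T_θ(Z_μ) = θ Z_μ + (1 - θ) Z_μ ∘ τ`.**
[cite: BorceaBrandenLiggett2007, §4.3 Thm. 4.20 and §5 proof of Prop. 5.1 ("`α f(z) + (1 - α) f(τ_{i,j}(z))`")] -/
theorem partitionPoly_partialSymmetrizationMeasure (θ : ℝ) (a b : σ) (μ : Set σ → ℝ) :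
    partitionPoly (partialSymmetrizationMeasure θ a b μ) =
      θ • partitionPoly μ + (1 - θ) • rename (Equiv.swap a b) (partitionPoly μ) := by
  have h : partialSymmetrizationMeasure θ a b μ = θ • μ + (1 - θ) • fun S ↦ μ (Equiv.swap a b '' S) := by
    funext S
    rfl
  rw [h, partitionPoly_add, partitionPoly_smul, partitionPoly_smul, rename_partitionPoly, Equiv.symm_swap]

omit [Fintype σ] in
/-- The partial symmetrization of a nonnegative weight is nonnegative for `θ ∈ [0,1]`.
[cite: BorceaBrandenLiggett2007, §4.3 Thm. 4.20] -/
theorem partialSymmetrizationMeasure_nonneg {θ : ℝ} (h0 : 0 ≤ θ) (h1 : θ ≤ 1) (a b : σ) {μ : Set σ → ℝ}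
    (hμ : ∀ S, 0 ≤ μ S) (S : Set σ) : 0 ≤ partialSymmetrizationMeasure θ a b μ S :=
  add_nonneg (mul_nonneg h0 (hμ S)) (mul_nonneg (sub_nonneg.2 h1) (hμ _))

/-- **Borcea–Brändén–Liggett, Theorem 4.20 ("In particular … the class of strongly Rayleigh measures on `2^{[n]}`
is invariant under the partial symmetrization procedure"); Prop. 5.1 for a single pair of sites**: if `μ` is
strongly Rayleigh then so is `θμ + (1 - θ)τ(μ)` for every transposition `τ = (a b)` and `θ ∈ [0,1]`. Proof: `Z_μ` is
`0` or real stable (§2); in the second case `θ Z_μ + (1 - θ) Z_μ ∘ τ` is real stable by the polynomial Thm. 4.20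
(`IsRealStable.partialSymmetrization`), and a weight with real stable partition function is strongly Rayleigh.
[cite: BorceaBrandenLiggett2007, §4.3 Thm. 4.20; §5 Prop. 5.1] [cite: BrandenHuh2019, §3.1 (before Cor. 3.9)] -/
theorem IsStronglyRayleighMeasure.partialSymmetrization {μ : Set σ → ℝ} (hR : IsStronglyRayleighMeasure μ)
    (a b : σ) {θ : ℝ} (h0 : 0 ≤ θ) (h1 : θ ≤ 1) :
    IsStronglyRayleighMeasure (partialSymmetrizationMeasure θ a b μ) := by
  rcases hR.eq_zero_or_isRealStable with hz | hst
  · have hμ : μ = 0 := (partitionPoly_eq_zero_iff μ).1 hz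
    have h : partialSymmetrizationMeasure θ a b μ = 0 := by
      funext S
      simp [partialSymmetrizationMeasure_apply, hμ]
    rw [h]
    exact isStronglyRayleighMeasure_zero
  · refine isStronglyRayleighMeasure_of_isRealStable ?_
    rw [partitionPoly_partialSymmetrizationMeasure]
    exact hst.partialSymmetrization (isMultiAffine_partitionPoly μ) a b h0 h1

/-- The partial symmetrization of a strongly Rayleigh nonnegative weight is Lorentzian (Prop. 4.24 applied after
Thm. 4.20) — the strongly-Rayleigh shadow of Brändén–Huh's Prop. 4.23 ("the class of Lorentzian measures is
preserved under the symmetric exclusion process", whose proof needs the Lorentzian symbol theorem Cor. 3.9).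
[cite: BrandenHuh2019, §4.5 Props. 4.23, 4.24] [cite: BorceaBrandenLiggett2007, §4.3 Thm. 4.20] -/
theorem IsStronglyRayleighMeasure.isLorentzianMeasure_partialSymmetrization {μ : Set σ → ℝ}
    (hR : IsStronglyRayleighMeasure μ) (hμ : ∀ S, 0 ≤ μ S) (a b : σ) {θ : ℝ} (h0 : 0 ≤ θ) (h1 : θ ≤ 1) :
    IsLorentzianMeasure (partialSymmetrizationMeasure θ a b μ) :=
  (hR.partialSymmetrization a b h0 h1).isLorentzianMeasure (partialSymmetrizationMeasure_nonneg h0 h1 a b hμ)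

end Symmetrization

end Literature.Combinatorics.LorentzianPolynomials

end
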